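import Literature.Analysis.FluidPDE.TorusLinearisedNSH1Balance
import HarnessLib

/-!
# The `H¹` balance of the two-background linearised Navier–Stokes equation on the torus

Analysis/FluidPDE proof file (theorems only; no definitions, no named facts), the TWO-BACKGROUND
twin of `TorusLinearisedNSH1Balance` (and of the energy identity of
`FunctionSpaces/TorusLinearisedNSEnergy`). For jointly smooth fields `u₁, u₂` on `[a, b] × T^d`
and a jointly smooth solution `(w, q)` of

`∂ₜw + (u₁·∇)w + (w·∇)u₂ = νΔw − ∇q`, `div w = 0`,

(the advecting background `u₁` and the stretched background `u₂` may differ — the equation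
satisfied by the difference of two linearised solutions along two trajectories, and by second
variations; clauses as separate hypotheses, no predicate) we prove, with the proofs of the
one-background case verbatim (each production term sees one background only):

* `Torus.twoBackground_hasDerivWithinAt_integral_norm_sq` — the energy identity
  `d/dt ∫ ‖w‖² = −2ν ‖∇w‖₂² − 2 ∫ ⟪(w·∇)u₂, w⟫` (the transport term `∫ ⟪(u₁·∇)w, w⟫` vanishes
  since `div u₁ = 0`, the pressure term since `div w = 0`);
* `Torus.twoBackground_hasDerivWithinAt_half_gradNormSq` — the enstrophy-type identity
  `d/dt ½‖∇w‖₂² = −ν ‖Δw‖₂² + ∫ ⟪(u₁·∇)w + (w·∇)u₂, Δw⟫` (pair the equation with `−Δw`; the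
  pressure drops out because `Δw` is divergence free; no incompressibility of `u₁, u₂` needed);
* `Torus.twoBackground_half_gradNormSq_flux_le` — for `ν > 0` and bounds `‖v₁‖ ≤ M`,
  `‖∂ᵢv₂‖ ≤ Cᵢ`: `−ν ∫ ‖Δw‖² + ∫ ⟪(v₁·∇)w + (w·∇)v₂, Δw⟫ ≤ (2ν)⁻¹ (|d| M² ‖∇w‖₂² + (∑ᵢ Cᵢ)² ∫ ‖w‖²)`
  (Young; `Torus.integral_norm_sq_convect_le_of_norm_le` for the transport term,
  `Torus.integral_norm_sq_convect_le_of_partialDeriv_le` for the production term);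
* `Torus.twoBackground_h1_le_mul_exp` — the **exponential `H¹` bound**
  `∫ ‖w(t)‖² + ‖∇w(t)‖₂² ≤ (∫ ‖w(a)‖² + ‖∇w(a)‖₂²) · exp(K'(t − a))`,
  `K' = 2∑ᵢ Cᵢ + ((∑ᵢ Cᵢ)² + |d| M²)/ν`, from `div u₁ = 0`, `‖u₁‖ ≤ M` and `‖∂ᵢu₂‖ ≤ Cᵢ` on
  `[a, b] × T^d` (Grönwall for `E + ‖∇w‖₂²`, the `L²` flux bound
  `Torus.linearisedNS_energy_flux_le` seeing `u₂` only).

Tree search (`lean search 'twoBackground|convect \(u₁ t\) \(w t\) x \+ .*convect \(w t\) \(u₂'`):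
nothing; the one-background chain `Torus.linearisedNS_hasDerivWithinAt_integral_norm_sq`,
`Torus.linearisedNS_hasDerivWithinAt_half_gradNormSq`, `Torus.linearisedNS_half_gradNormSq_flux_le`,
`Torus.linearisedNS_h1_le_mul_exp` is hard-wired to `u₁ = u₂`.

## References

* P. Constantin, C. Foias, *Navier–Stokes Equations*, Chicago Lectures in Math. (1988), Ch. 14,
  (14.2)–(14.6), and Prop. 13.2. [`ConstantinFoiasNSE1988`]
* C. Foias, O. Manley, R. Rosa, R. Temam, *Navier–Stokes Equations and Turbulence*, CUP 2001,
  App. II.A, (A.55). [`FoiasManleyRosaTemam2001`]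
* R. Temam, *Infinite-Dimensional Dynamical Systems in Mechanics and Physics*, 2nd ed. (1997),
  Ch. VI §3.1, (3.7)–(3.11). [`Temam1997`]
-/

noncomputable section

open MeasureTheory Set Filter Function
open scoped ContDiff InnerProductSpace RealInnerProductSpace Topology

namespace Literature.Analysis.FluidPDE

open Literature.Analysis.FunctionSpaces

variable {d : Type*} [Fintype d] [DecidableEq d]

/-! ### The energy identity -/

/-- **Energy identity for the two-background linearised Navier–Stokes equation.** Let `u₁, u₂`
be jointly smooth on `[a, b] × T^d` (`a < b`), `u₁` with divergence-free slices, and let `(w, q)`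
be jointly smooth with `div w(t) = 0` and `∂ₜw + (u₁·∇)w + (w·∇)u₂ = νΔw − ∇q` pointwise on
`[a, b] × T^d` (one-sided time derivative within `[a, b]`). Then `t ↦ ∫ ‖w(t)‖²` has the
one-sided derivative `−2ν ‖∇w(t)‖₂² − 2 ∫ ⟪(w·∇)u₂, w⟫(t)` within `[a, b]`: differentiate under
the integral, insert the equation; the transport term `∫ ⟪(u₁·∇)w, w⟫` vanishes because
`div u₁ = 0`, the pressure term because `div w = 0`, and `∫ ⟪Δw, w⟫ = −‖∇w‖₂²` (the first energy
equation of the linearised problem, Constantin–Foias 1988, Ch. 14, (14.3)–(14.4), with the two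
backgrounds decoupled). [cite: ConstantinFoiasNSE1988, Ch. 14 (14.3)–(14.4)] -/
theorem Torus.twoBackground_hasDerivWithinAt_integral_norm_sq
    {a b ν : ℝ} {u₁ u₂ w : ℝ → UnitAddTorus d → EuclideanSpace ℝ d} {q : ℝ → UnitAddTorus d → ℝ}
    (hu₁ : Torus.IsSmoothSpaceTimeOn (Icc a b) u₁) (hu₁div : ∀ t ∈ Icc a b, Torus.IsDivFree (u₁ t))
    (hu₂ : Torus.IsSmoothSpaceTimeOn (Icc a b) u₂)
    (hw : Torus.IsSmoothSpaceTimeOn (Icc a b) w) (hq : Torus.IsSmoothSpaceTimeOn (Icc a b) q)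
    (hwdiv : ∀ t ∈ Icc a b, Torus.IsDivFree (w t))
    (hlin : ∀ t ∈ Icc a b, ∀ x, Torus.timeDerivWithin (Icc a b) w t x +
      Torus.convect (u₁ t) (w t) x + Torus.convect (w t) (u₂ t) x =
        ν • Torus.laplacian (w t) x - Torus.gradient (q t) x)
    (hab : a < b) {t : ℝ} (ht : t ∈ Icc a b) :
    HasDerivWithinAt (fun s => ∫ x, ‖w s x‖ ^ 2)
      (-(2 * ν * Torus.gradNormSq (w t)) - 2 * ∫ x, ⟪Torus.convect (w t) (u₂ t) x, w t x⟫)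
      (Icc a b) t := by
  -- adapted from `Torus.linearisedNS_hasDerivWithinAt_integral_norm_sq` (`TorusLinearisedNSEnergy`)
  have hU : UniqueDiffOn ℝ (Icc a b) := uniqueDiffOn_Icc hab
  have hwt : Torus.IsSmooth (w t) := hw.isSmooth_slice ht
  have hu₁t : Torus.IsSmooth (u₁ t) := hu₁.isSmooth_slice ht
  have hu₂t : Torus.IsSmooth (u₂ t) := hu₂.isSmooth_slice ht
  have hqt : Torus.IsSmooth (q t) := hq.isSmooth_slice ht
  -- differentiate under the integral sign
  have hφ : Torus.IsSmoothSpaceTimeOn (Icc a b) (fun s x => ‖w s x‖ ^ 2) := hw.norm_sq ℝ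
  refine (hφ.hasDerivWithinAt_integral (convex_Icc a b) ht).congr_deriv ?_
  -- `∂ₜ‖w‖² = 2⟪∂ₜw, w⟫`
  have hpt : ∀ x, Torus.timeDerivWithin (Icc a b) (fun s x => ‖w s x‖ ^ 2) t x =
      2 * ⟪Torus.timeDerivWithin (Icc a b) w t x, w t x⟫ := by
    intro x
    have h2 := ((hw.hasDerivWithinAt_slice ht x).norm_sq).derivWithin (hU t ht)
    rw [real_inner_comm] at h2
    exact h2
  -- the equation for `∂ₜw`
  have hderiv : ∀ x, Torus.timeDerivWithin (Icc a b) w t x =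
      ν • Torus.laplacian (w t) x - Torus.gradient (q t) x -
        (Torus.convect (u₁ t) (w t) x + Torus.convect (w t) (u₂ t) x) := by
    intro x
    rw [← hlin t ht x]
    abel
  -- integrability of the four terms
  have hi0 : Integrable (fun x => ⟪Torus.laplacian (w t) x, w t x⟫) volume :=
    (hwt.laplacian.inner hwt).integrable
  have hi1 : Integrable (fun x => ⟪Torus.convect (u₁ t) (w t) x, w t x⟫) volume :=
    ((hu₁t.convect hwt).inner hwt).integrable
  have hi2 : Integrable (fun x => ⟪Torus.convect (w t) (u₂ t) x, w t x⟫) volume :=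
    ((hwt.convect hu₂t).inner hwt).integrable
  have hi3 : Integrable (fun x => ⟪Torus.gradient (q t) x, w t x⟫) volume :=
    (hqt.gradient.inner hwt).integrable
  have hi12 : Integrable (fun x => ⟪Torus.convect (u₁ t) (w t) x, w t x⟫ +
      ⟪Torus.convect (w t) (u₂ t) x, w t x⟫) volume := hi1.add hi2
  have hiν : Integrable (fun x => ν * ⟪Torus.laplacian (w t) x, w t x⟫) volume := hi0.const_mul ν
  have hiνq : Integrable (fun x => ν * ⟪Torus.laplacian (w t) x, w t x⟫ -
      ⟪Torus.gradient (q t) x, w t x⟫) volume := hiν.sub hi3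
  simp_rw [hpt, hderiv, inner_sub_left, inner_add_left, real_inner_smul_left]
  rw [integral_const_mul, integral_sub hiνq hi12, integral_sub hiν hi3, integral_const_mul,
    integral_add hi1 hi2, Torus.integral_inner_convect_self_right_eq_zero hu₁t (hu₁div t ht) hwt,
    Torus.integral_inner_gradient_eq_zero_of_isDivFree hwt hqt (hwdiv t ht),
    Torus.integral_inner_laplacian_self_eq_neg_gradNormSq_of_isSmooth hwt]
  ring

/-! ### The `H¹` balance -/

/-- **The `H¹` balance of the two-background linearised Navier–Stokes equation on the torus.**
Let `u₁, u₂` be jointly smooth on `[a, b] × T^d` (`a < b`) and let `(w, q)` be jointly smooth with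
`div w(t) = 0` and `∂ₜw + (u₁·∇)w + (w·∇)u₂ = νΔw − ∇q` pointwise on `[a, b] × T^d` (one-sided
time derivative within `[a, b]`). Then for every `t ∈ [a, b]`,
`d/dt ½‖∇w(t)‖₂² = −ν (∫ ‖Δw(t)‖²) + ∫ ⟪(u₁·∇)w(t) + (w·∇)u₂(t), Δw(t)⟫`
as a one-sided derivative within `[a, b]` ("the inner product of the equation with `AU`",
Foias–Manley–Rosa–Temam 2001, App. II.A, (A.55); Constantin–Foias 1988, (14.3)): differentiate
`½ ∫ ∑ᵢ ‖∂ᵢw‖²` under the integral, `∂ₜ∂ᵢ = ∂ᵢ∂ₜ` (`Torus.timeDerivWithin_partialDeriv_comm`),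
Green (`Torus.sum_integral_inner_partialDeriv_eq_neg_integral_inner_laplacian`), insert the
equation, and drop `∫ ⟪∇q, Δw⟫ = 0` (`Torus.IsDivFree.laplacian_of_isSmooth`). Incompressibility
of the backgrounds is not needed. [cite: FoiasManleyRosaTemam2001, App. II.A (A.55)] -/
theorem Torus.twoBackground_hasDerivWithinAt_half_gradNormSq
    {a b ν : ℝ} {u₁ u₂ w : ℝ → UnitAddTorus d → EuclideanSpace ℝ d} {q : ℝ → UnitAddTorus d → ℝ}
    (hu₁ : Torus.IsSmoothSpaceTimeOn (Icc a b) u₁) (hu₂ : Torus.IsSmoothSpaceTimeOn (Icc a b) u₂)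
    (hw : Torus.IsSmoothSpaceTimeOn (Icc a b) w) (hq : Torus.IsSmoothSpaceTimeOn (Icc a b) q)
    (hwdiv : ∀ t ∈ Icc a b, Torus.IsDivFree (w t))
    (hlin : ∀ t ∈ Icc a b, ∀ x, Torus.timeDerivWithin (Icc a b) w t x +
      Torus.convect (u₁ t) (w t) x + Torus.convect (w t) (u₂ t) x =
        ν • Torus.laplacian (w t) x - Torus.gradient (q t) x)
    (hab : a < b) {t : ℝ} (ht : t ∈ Icc a b) :
    HasDerivWithinAt (fun s => 2⁻¹ * Torus.gradNormSq (w s))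
      (-ν * (∫ x, ‖Torus.laplacian (w t) x‖ ^ 2) +
        ∫ x, ⟪Torus.convect (u₁ t) (w t) x + Torus.convect (w t) (u₂ t) x,
          Torus.laplacian (w t) x⟫) (Icc a b) t := by
  -- adapted from `Torus.linearisedNS_hasDerivWithinAt_half_gradNormSq` (`TorusLinearisedNSH1Balance`)
  set S : Set ℝ := Icc a b with hSdef
  have hSc : Convex ℝ S := convex_Icc a b
  have hU : UniqueDiffOn ℝ S := uniqueDiffOn_Icc hab
  have hwt : Torus.IsSmooth (w t) := hw.isSmooth_slice ht
  have hu₁t : Torus.IsSmooth (u₁ t) := hu₁.isSmooth_slice ht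
  have hu₂t : Torus.IsSmooth (u₂ t) := hu₂.isSmooth_slice ht
  have hqt : Torus.IsSmooth (q t) := hq.isSmooth_slice ht
  have hA : Torus.IsSmooth (Torus.timeDerivWithin S w t) := hw.isSmooth_timeDerivWithin hU ht
  have hΔ : Torus.IsSmooth (Torus.laplacian (w t)) := hwt.laplacian
  have hDi : ∀ i, Torus.IsSmoothSpaceTimeOn S (fun s => Torus.partialDeriv i (w s)) :=
    fun i => hw.partialDeriv hU i
  -- Step 1: differentiate `½ ∫ ∑ᵢ ‖∂ᵢw‖²` under the integral sign.
  have hφ : Torus.IsSmoothSpaceTimeOn S (fun s x => ∑ i, ‖Torus.partialDeriv i (w s) x‖ ^ 2) := by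
    change ContDiffOn ℝ ∞
      (fun z => ∑ i, ‖Torus.stLift (fun s => Torus.partialDeriv i (w s)) z‖ ^ 2) (S ×ˢ univ)
    exact ContDiffOn.sum fun i _ => (hDi i).norm_sq ℝ
  have hE : HasDerivWithinAt (fun s => 2⁻¹ * Torus.gradNormSq (w s))
      (2⁻¹ * ∫ x, Torus.timeDerivWithin S
        (fun s x => ∑ i, ‖Torus.partialDeriv i (w s) x‖ ^ 2) t x) S t :=
    (hφ.hasDerivWithinAt_integral hSc ht).const_mul 2⁻¹
  -- Step 2: `∂ₜ ∑ᵢ ‖∂ᵢw‖² = 2 ∑ᵢ ⟪∂ᵢ∂ₜw, ∂ᵢw⟫`.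
  have htd : ∀ x, Torus.timeDerivWithin S (fun s x => ∑ i, ‖Torus.partialDeriv i (w s) x‖ ^ 2) t x =
      2 * ∑ i, ⟪Torus.partialDeriv i (Torus.timeDerivWithin S w t) x,
        Torus.partialDeriv i (w t) x⟫ := by
    intro x
    have hsum := HasDerivWithinAt.fun_sum (u := Finset.univ)
      (A := fun i s => ‖Torus.partialDeriv i (w s) x‖ ^ 2)
      (A' := fun i => 2 * ⟪Torus.partialDeriv i (w t) x,
        Torus.timeDerivWithin S (fun s => Torus.partialDeriv i (w s)) t x⟫) (x := t) (s := S)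
      fun i _ => ((hDi i).hasDerivWithinAt_slice ht x).norm_sq
    have h2 := hsum.derivWithin (hU t ht)
    rw [Torus.timeDerivWithin, h2, Finset.mul_sum]
    refine Finset.sum_congr rfl fun i _ => ?_
    rw [Torus.timeDerivWithin_partialDeriv_comm hab hw ht i x, real_inner_comm]
  -- Step 3: Green, `∑ᵢ ∫ ⟪∂ᵢ∂ₜw, ∂ᵢw⟫ = -∫ ⟪∂ₜw, Δw⟫`.
  have hE' : 2⁻¹ * ∫ x, Torus.timeDerivWithin S
        (fun s x => ∑ i, ‖Torus.partialDeriv i (w s) x‖ ^ 2) t x =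
      -∫ x, ⟪Torus.timeDerivWithin S w t x, Torus.laplacian (w t) x⟫ := by
    simp_rw [htd, integral_const_mul]
    rw [integral_finsetSum _ fun i _ => ((hA.partialDeriv i).inner (hwt.partialDeriv i)).integrable,
      Torus.sum_integral_inner_partialDeriv_eq_neg_integral_inner_laplacian hA hwt]
    ring
  rw [hE'] at hE
  convert hE using 1
  -- Step 4: insert the equation; the pressure term drops out.
  have hA_eq : ∀ x, Torus.timeDerivWithin S w t x = ν • Torus.laplacian (w t) x -
      Torus.gradient (q t) x - (Torus.convect (u₁ t) (w t) x + Torus.convect (w t) (u₂ t) x) := by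
    intro x
    rw [← hlin t ht x]
    abel
  have hF : Torus.IsSmooth (fun x => Torus.convect (u₁ t) (w t) x + Torus.convect (w t) (u₂ t) x) :=
    (hu₁t.convect hwt).add (hwt.convect hu₂t)
  have iL : Integrable (fun x => ⟪ν • Torus.laplacian (w t) x, Torus.laplacian (w t) x⟫) volume :=
    ((hΔ.smul ν).inner hΔ).integrable
  have iG : Integrable (fun x => ⟪Torus.gradient (q t) x, Torus.laplacian (w t) x⟫) volume :=
    (hqt.gradient.inner hΔ).integrable
  have iF : Integrable (fun x => ⟪Torus.convect (u₁ t) (w t) x + Torus.convect (w t) (u₂ t) x,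
      Torus.laplacian (w t) x⟫) volume := (hF.inner hΔ).integrable
  have hsplit : ∫ x, ⟪Torus.timeDerivWithin S w t x, Torus.laplacian (w t) x⟫ =
      (∫ x, ⟪ν • Torus.laplacian (w t) x, Torus.laplacian (w t) x⟫) -
        (∫ x, ⟪Torus.gradient (q t) x, Torus.laplacian (w t) x⟫) -
        ∫ x, ⟪Torus.convect (u₁ t) (w t) x + Torus.convect (w t) (u₂ t) x,
          Torus.laplacian (w t) x⟫ := by
    simp_rw [hA_eq, inner_sub_left]
    rw [integral_sub ?_ iF, integral_sub iL iG]
    exact iL.sub iG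
  have hvisc : ∫ x, ⟪ν • Torus.laplacian (w t) x, Torus.laplacian (w t) x⟫ =
      ν * ∫ x, ‖Torus.laplacian (w t) x‖ ^ 2 := by
    rw [← integral_const_mul]
    refine integral_congr_ae (ae_of_all _ fun x => ?_)
    simp only [real_inner_smul_left, real_inner_self_eq_norm_sq]
  have hpres : ∫ x, ⟪Torus.gradient (q t) x, Torus.laplacian (w t) x⟫ = 0 :=
    Torus.integral_inner_gradient_eq_zero_of_isDivFree hΔ hqt
      (Torus.IsDivFree.laplacian_of_isSmooth hwt (hwdiv t ht))
  rw [hsplit, hvisc, hpres]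
  ring

/-- **The `H¹` flux of the two-background linearised equation is controlled by the `H¹` energy**
(`ν > 0`). For smooth `v₁, v₂, w : T^d → ℝ^d` with `‖v₁‖ ≤ M` and `‖∂ᵢv₂‖ ≤ Cᵢ` on `T^d`,
`−ν ∫ ‖Δw‖² + ∫ ⟪(v₁·∇)w + (w·∇)v₂, Δw⟫ ≤ (2ν)⁻¹ (|d| M² ‖∇w‖₂² + (∑ᵢ Cᵢ)² ∫ ‖w‖²)`
(Young, `Torus.neg_mul_integral_norm_sq_add_integral_inner_le`; `‖F + G‖² ≤ 2‖F‖² + 2‖G‖²`;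
`Torus.integral_norm_sq_convect_le_of_norm_le` sees `v₁` only,
`Torus.integral_norm_sq_convect_le_of_partialDeriv_le` sees `v₂` only). [folklore] -/
theorem Torus.twoBackground_half_gradNormSq_flux_le {ν : ℝ} (hν : 0 < ν)
    {v₁ v₂ w : UnitAddTorus d → EuclideanSpace ℝ d} (hv₁ : Torus.IsSmooth v₁)
    (hv₂ : Torus.IsSmooth v₂) (hw : Torus.IsSmooth w) {M : ℝ} (hM : ∀ x, ‖v₁ x‖ ≤ M) {C : d → ℝ}
    (hC : ∀ i x, ‖Torus.partialDeriv i v₂ x‖ ≤ C i) :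
    -ν * (∫ x, ‖Torus.laplacian w x‖ ^ 2) +
        ∫ x, ⟪Torus.convect v₁ w x + Torus.convect w v₂ x, Torus.laplacian w x⟫ ≤
      (2 * ν)⁻¹ * ((Fintype.card d) * M ^ 2 * Torus.gradNormSq w +
        (∑ i, C i) ^ 2 * ∫ x, ‖w x‖ ^ 2) := by
  -- adapted from `Torus.linearisedNS_half_gradNormSq_flux_le` (`TorusLinearisedNSH1Balance`)
  have hF1 : Torus.IsSmooth (Torus.convect v₁ w) := hv₁.convect hw
  have hF2 : Torus.IsSmooth (Torus.convect w v₂) := hw.convect hv₂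
  have hF : Torus.IsSmooth (fun x => Torus.convect v₁ w x + Torus.convect w v₂ x) := hF1.add hF2
  have hY := Torus.neg_mul_integral_norm_sq_add_integral_inner_le hν hF hw.laplacian
  -- `‖F₁ + F₂‖² ≤ 2‖F₁‖² + 2‖F₂‖²`
  have hsum : ∫ x, ‖Torus.convect v₁ w x + Torus.convect w v₂ x‖ ^ 2 ≤
      2 * (∫ x, ‖Torus.convect v₁ w x‖ ^ 2) + 2 * ∫ x, ‖Torus.convect w v₂ x‖ ^ 2 := by
    rw [← integral_const_mul, ← integral_const_mul,
      ← integral_add ((hF1.norm_sq.integrable).const_mul 2) ((hF2.norm_sq.integrable).const_mul 2)]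
    refine integral_mono_of_nonneg (Eventually.of_forall fun x => sq_nonneg _)
      (((hF1.norm_sq.integrable).const_mul 2).add ((hF2.norm_sq.integrable).const_mul 2))
      (Eventually.of_forall fun x => ?_)
    have h := norm_add_sq_real (Torus.convect v₁ w x) (Torus.convect w v₂ x)
    have hcs := abs_real_inner_le_norm (Torus.convect v₁ w x) (Torus.convect w v₂ x)
    have hab := (abs_le.1 hcs).2
    nlinarith [sq_nonneg (‖Torus.convect v₁ w x‖ - ‖Torus.convect w v₂ x‖)]
  have h1 := Torus.integral_norm_sq_convect_le_of_norm_le hw hM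
  have h2 := Torus.integral_norm_sq_convect_le_of_partialDeriv_le hv₂ hw hC
  have hν2 : 0 < (2 * ν)⁻¹ := by positivity
  have hν4 : (4 * ν)⁻¹ = (2 * ν)⁻¹ * 2⁻¹ := by
    rw [← mul_inv]; congr 1; ring
  calc -ν * (∫ x, ‖Torus.laplacian w x‖ ^ 2) +
        ∫ x, ⟪Torus.convect v₁ w x + Torus.convect w v₂ x, Torus.laplacian w x⟫
      ≤ (4 * ν)⁻¹ * ∫ x, ‖Torus.convect v₁ w x + Torus.convect w v₂ x‖ ^ 2 := hY
    _ ≤ (4 * ν)⁻¹ * (2 * (∫ x, ‖Torus.convect v₁ w x‖ ^ 2) + 2 * ∫ x, ‖Torus.convect w v₂ x‖ ^ 2) :=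
        mul_le_mul_of_nonneg_left hsum (by positivity)
    _ = (2 * ν)⁻¹ * ((∫ x, ‖Torus.convect v₁ w x‖ ^ 2) + ∫ x, ‖Torus.convect w v₂ x‖ ^ 2) := by
        rw [hν4]; ring
    _ ≤ (2 * ν)⁻¹ * ((Fintype.card d) * M ^ 2 * Torus.gradNormSq w +
        (∑ i, C i) ^ 2 * ∫ x, ‖w x‖ ^ 2) :=
        mul_le_mul_of_nonneg_left (add_le_add h1 h2) hν2.le

/-- **Exponential `H¹` bound for the two-background linearised Navier–Stokes equation
(`ν > 0`).** Let `u₁, u₂` be jointly smooth on `[a, b] × T^d`, `u₁` with divergence-free slices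
and `‖u₁‖ ≤ M`, `u₂` with `‖∂ᵢu₂‖ ≤ Cᵢ` there, and let `(w, q)` be jointly smooth with
`div w(t) = 0` and `∂ₜw + (u₁·∇)w + (w·∇)u₂ = νΔw − ∇q` pointwise (one-sided time derivative
within `[a, b]`). Then for all `t ∈ [a, b]`,
`∫ ‖w(t)‖² + ‖∇w(t)‖₂² ≤ (∫ ‖w(a)‖² + ‖∇w(a)‖₂²) · exp(K'(t − a))` with
`K' = 2∑ᵢ Cᵢ + ((∑ᵢ Cᵢ)² + |d| M²)/ν`: add the `L²` balance `E' ≤ 2(∑ᵢ Cᵢ) E`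
(`Torus.linearisedNS_energy_flux_le`, which sees `u₂` only) and twice the `H¹` balance with its
flux bound, `G' ≤ ν⁻¹(|d| M² G + (∑ᵢ Cᵢ)² E)`, and apply Grönwall to `E + G` (Mathlib
`le_gronwallBound_of_liminf_deriv_right_le`) — the one-background proof
`Torus.linearisedNS_h1_le_mul_exp` verbatim. [folklore] -/
theorem Torus.twoBackground_h1_le_mul_exp
    {a b ν : ℝ} {u₁ u₂ w : ℝ → UnitAddTorus d → EuclideanSpace ℝ d} {q : ℝ → UnitAddTorus d → ℝ}
    (hν : 0 < ν) (hu₁ : Torus.IsSmoothSpaceTimeOn (Icc a b) u₁)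
    (hu₁div : ∀ t ∈ Icc a b, Torus.IsDivFree (u₁ t))
    (hu₂ : Torus.IsSmoothSpaceTimeOn (Icc a b) u₂)
    (hw : Torus.IsSmoothSpaceTimeOn (Icc a b) w) (hq : Torus.IsSmoothSpaceTimeOn (Icc a b) q)
    (hwdiv : ∀ t ∈ Icc a b, Torus.IsDivFree (w t))
    (hlin : ∀ t ∈ Icc a b, ∀ x, Torus.timeDerivWithin (Icc a b) w t x +
      Torus.convect (u₁ t) (w t) x + Torus.convect (w t) (u₂ t) x =
        ν • Torus.laplacian (w t) x - Torus.gradient (q t) x)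
    {M : ℝ} (hM : ∀ t ∈ Icc a b, ∀ x, ‖u₁ t x‖ ≤ M)
    {C : d → ℝ} (hC : ∀ i, ∀ t ∈ Icc a b, ∀ x, ‖Torus.partialDeriv i (u₂ t) x‖ ≤ C i)
    {t : ℝ} (ht : t ∈ Icc a b) :
    (∫ x, ‖w t x‖ ^ 2) + Torus.gradNormSq (w t) ≤
      ((∫ x, ‖w a x‖ ^ 2) + Torus.gradNormSq (w a)) *
        Real.exp ((2 * ∑ i, C i + ((∑ i, C i) ^ 2 + (Fintype.card d) * M ^ 2) / ν) * (t - a)) := by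
  -- adapted from `Torus.linearisedNS_h1_le_mul_exp` (`TorusLinearisedNSH1Balance`)
  rcases lt_or_ge a b with hab | hba
  · have ha : a ∈ Icc a b := ⟨le_rfl, hab.le⟩
    have hL0 : 0 ≤ ∑ i, C i := Finset.sum_nonneg fun i _ => (norm_nonneg _).trans (hC i a ha 0)
    set Y : ℝ → ℝ := fun s => (∫ x, ‖w s x‖ ^ 2) + Torus.gradNormSq (w s) with hY_def
    set Y' : ℝ → ℝ := fun s =>
      (-(2 * ν * Torus.gradNormSq (w s)) - 2 * ∫ x, ⟪Torus.convect (w s) (u₂ s) x, w s x⟫) +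
        2 * (-ν * (∫ x, ‖Torus.laplacian (w s) x‖ ^ 2) +
          ∫ x, ⟪Torus.convect (u₁ s) (w s) x + Torus.convect (w s) (u₂ s) x,
            Torus.laplacian (w s) x⟫) with hY'_def
    have hYd : ∀ s ∈ Icc a b, HasDerivWithinAt Y (Y' s) (Icc a b) s := by
      intro s hs
      have h1 := Torus.twoBackground_hasDerivWithinAt_integral_norm_sq hu₁ hu₁div hu₂ hw hq hwdiv
        hlin hab hs
      have h2 := (Torus.twoBackground_hasDerivWithinAt_half_gradNormSq hu₁ hu₂ hw hq hwdiv hlin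
        hab hs).const_mul 2
      have h2' : HasDerivWithinAt (fun r => Torus.gradNormSq (w r))
          (2 * (-ν * (∫ x, ‖Torus.laplacian (w s) x‖ ^ 2) +
            ∫ x, ⟪Torus.convect (u₁ s) (w s) x + Torus.convect (w s) (u₂ s) x,
              Torus.laplacian (w s) x⟫)) (Icc a b) s := by
        refine h2.congr (fun r _ => ?_) ?_ <;> ring
      exact h1.add h2'
    -- `Y' ≤ 2(∑C)·E + ν⁻¹(|d|M² G + (∑C)² E) ≤ K' (E + G)`
    have hY'le : ∀ s ∈ Icc a b,
        Y' s ≤ (2 * ∑ i, C i + ((∑ i, C i) ^ 2 + (Fintype.card d) * M ^ 2) / ν) * Y s := by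
      intro s hs
      have hu₁s := hu₁.isSmooth_slice hs
      have hu₂s := hu₂.isSmooth_slice hs
      have hws := hw.isSmooth_slice hs
      have hE := Torus.linearisedNS_energy_flux_le hν.le hu₂s hws fun i x => hC i s hs x
      have hG := Torus.twoBackground_half_gradNormSq_flux_le hν hu₁s hu₂s hws (hM s hs)
        fun i x => hC i s hs x
      have hE0 : 0 ≤ ∫ x, ‖w s x‖ ^ 2 := integral_nonneg fun x => sq_nonneg _
      have hG0 : 0 ≤ Torus.gradNormSq (w s) := Torus.gradNormSq_nonneg _
      have hM2 : 0 ≤ (Fintype.card d : ℝ) * M ^ 2 := by positivity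
      have hr0 : 0 ≤ ν⁻¹ := inv_nonneg.2 hν.le
      have hr : (2 * ν)⁻¹ = 2⁻¹ * ν⁻¹ := by rw [mul_inv]
      rw [hr] at hG
      simp only [hY'_def, hY_def, div_eq_mul_inv]
      nlinarith [hE, hG, mul_nonneg (mul_nonneg zero_le_two hL0) hG0,
        mul_nonneg (mul_nonneg hM2 hr0) hE0,
        mul_nonneg (mul_nonneg (sq_nonneg (∑ i, C i)) hr0) hG0]
    have hYc : ContinuousOn Y (Icc a b) := fun s hs => (hYd s hs).continuousWithinAt
    have hder : ∀ s ∈ Ico a b, HasDerivWithinAt Y (Y' s) (Ici s) s := fun s hs =>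
      ((hYd s (Ico_subset_Icc_self hs)).mono (Icc_subset_Icc hs.1 le_rfl)).mono_of_mem_nhdsWithin
        (Icc_mem_nhdsGE hs.2)
    have hgr := le_gronwallBound_of_liminf_deriv_right_le (f := Y) (f' := Y') (δ := Y a)
      (K := 2 * ∑ i, C i + ((∑ i, C i) ^ 2 + (Fintype.card d) * M ^ 2) / ν) (ε := 0) (a := a)
      (b := b) hYc (fun s hs r hr => (hder s hs).liminf_right_slope_le hr) le_rfl
      (fun s hs => by
        rw [add_zero]
        exact hY'le s (Ico_subset_Icc_self hs)) t ht
    rwa [gronwallBound_ε0] at hgr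
  · have hta : t = a := le_antisymm (ht.2.trans hba) ht.1
    rw [hta, sub_self, mul_zero, Real.exp_zero, mul_one]

end Literature.Analysis.FluidPDE

end
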